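/-
Copyright (c) 2026 the pub-hodgecm-mathlib formalisation cell (harness21).  Prover seat hodgecm-mathlib-K2E3-p25 (g3) (L4 architect), HCML Track B «K2-LIT» ∕ h413
(`stmt-HodgeConjecture-24833`).  NR-1′ «LeThree SWEEP» (director s1979∕s1980): the hHC∕hHCB-binding theorems of ★ `F0P3cStCharTSHFields` RE-READ under the NARROWED letters
hHC₃ `characterLocallyIntegrableLeThree` ∕ hHCB₃ `normalizedCharacter_locallyBoundedLeThree` (`2 ≤ N ≤ 3`, `v` non-split) — SAME NAMES, namespace `…K2E3HFieldsLeThree`.  2026-09-04.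
-/
import Summits.HodgeConjecture.HodgeConjecture.Theorems.F0P3cStCharTSM1hOfCharH       -- ★ (this seat) S12b «M1H-OF-CHARH★»: `packetCharHRegularity_of_singleton` (brings ★ SocketsOut, ★ Ch12Sec5Inputs, `IsLocSmooth`, `Gqs`)
import Summits.HodgeConjecture.HodgeConjecture.Theorems.F0P3cStCharTSCharField          -- ★ (LH6-p01) S1 «CHAR-FIELD★»: `exists_charRegular_of_characterLocallyIntegrable_of_nonsplit` (generic `N`), named fact ★ `Ch1.characterLocallyIntegrable`
import Literature.NumberTheory.Rogawski1990.LocalTransfer                                -- ★ `IsLocalGRegular`, `IsLocalStablyConjH` (the pins' tokens)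
import Literature.NumberTheory.Rogawski1990.LocalCentralizerTorusMeasureCM               -- ★ `isRegularElt_fst_snd_of_isLocalGRegular`
import Summits.HodgeConjecture.HodgeConjecture.Theorems.F0P3cStCharTSBoxCharFn         -- ★ (F0P2-p02 g19) p851425 «BOXCHAR-FN★»: `smoothTrace_boxChar_eq_integral`, `measurable_boxCharFn`, `locallyIntegrable_boxCharFn`, `eventually_boxCharFn_eq`
import Literature.NumberTheory.Automorphic.UnitaryGroupPrincipalSeriesHLattice            -- ★ `HLengthTwoLabels.exists_eq_boxChar` (πSt = πSt₂ ⊠ χ₁)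
import Summits.HodgeConjecture.HodgeConjecture.Theorems.F0P3XiPacketFamilyOfRecord       -- ★ `isAdmissible_of_isConstituentOf`
import Literature.NumberTheory.Automorphic.SmoothInductionAdmissibleOfCocompact          -- ★ `isAdmissible_cmPrincipalSeries_of_iwasawa`
import Literature.NumberTheory.Automorphic.UnitaryGroupCMLocalIwasawa                    -- ★ `exists_borel_mul_mem_cmLocalIntegralLevel`
import Summits.HodgeConjecture.HodgeConjecture.Theorems.F0P3bHPrincipalSeriesJHOfUTwo    -- ★ `isOpen_ker_of_continuous_unitsComplex`; ★ `nonarchimedeanGroup_unitaryGroupOfForm_local`, `continuous_torusLocalComponent`, `continuous_localDet`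
import Literature.NumberTheory.Rogawski1990.LocalTransferUnmatchedLocus                  -- ★ `compactSpace_cmDatum_local_one_of_smul_eq` (`U(Φ₁)(L⁺_v)` compact at non-split `v`)
import Literature.NumberTheory.Automorphic.LocalUnitaryGroupCongr                        -- ★ `antidiagOne_isHermitian`, `isUnit_antidiagOne_det`
import HarnessLib
import Summits.HodgeConjecture.HodgeConjecture.Theorems.F0P3cStCharTSHFields   -- ★ the original: every non-letter lemma REUSED by qualified name
import Summits.HodgeConjecture.HodgeConjecture.Theorems.K2E3CharLettersLeThreeDefs   -- NR-1′ root: hHC₃ ∕ hHCB₃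
import Summits.HodgeConjecture.HodgeConjecture.Theorems.K2E3CharFieldLeThree   -- NR-1′ twin of ★ CharField

/-!
# NR-1′ twin — ★ `F0P3cStCharTSHFields` under the narrowed Harish-Chandra letters (`2 ≤ N ≤ 3`, `v` non-split)

Cell `pub/hodgecm-mathlib`, crux H413 = `stmt-HodgeConjecture-24833`, line L4 `stub_StCharTS`; director rulings NR-1′ (s1979) ∕ «GO — LeThree SWEEP» (s1980); architect memo
`K2/K2E3-p25/g3/NR1-narrowing-cone.K2E3-p25-g3.md`.  THEOREMS ONLY; count-neutral helper (`--supports stmt-HodgeConjecture-24833 --as helper`).  Exactly the theorems of the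
original ★ file whose statements bind `Ch1.characterLocallyIntegrable` ∕ `normalizedCharacter_locallyBounded`, copied with the binder TYPE replaced by hHC₃ ∕ hHCB₃
(★ `K2E3CharLettersLeThreeDefs`), the rank∕non-split arguments supplied at each application (`2 ≤ N`, `N ≤ 3` by `norm_num`; the organ's `∀ w ∣ v, conj • w = w`), an added `hns`
binder where the original head was place-agnostic, and calls into other cone files re-pointed to their twins; every other lemma of the original is used BY QUALIFIED NAME.
No new mathematics.  The original ★ declarations are untouched.

HONEST LABEL: HC_CM is proved only modulo the 7 printed citations (2 remaining named inputs: hLiu418 = `stmt-HodgeConjecture-24832`, h413 = `stmt-HodgeConjecture-24833`) until rung 0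
closes; count-neutral; CONDITIONAL on the narrowed letters (stated, not assumed).

## References
* [Rogawski1990] J. D. Rogawski, *Automorphic Representations of Unitary Groups in Three Variables* (1990), §1.6 p. 5; §4.9 p. 54; §12.5–12.7.
* [HarishChandra1999AdmissibleDistributions] Harish-Chandra, *Admissible Invariant Distributions on Reductive p-adic Groups*, ULS 16 (1999), Thm. 16.3.
-/

set_option autoImplicit false
-- the mandated namespace has the single-problem summit's repeated segment (`HodgeConjecture.HodgeConjecture`)
set_option linter.dupNamespace false

noncomputable section

open NumberField IsDedekindDomain MeasureTheory Filter Topology Set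
open scoped Matrix MatrixGroups NNReal ENNReal
open Literature.NumberTheory.Rogawski1990 Literature.NumberTheory.Automorphic Literature.NumberTheory.Automorphic.UnitaryGroup
open Literature.NumberTheory.Rogawski1990.Ch12Sec5

open Summit.HodgeConjecture.HodgeConjecture.Cruxes.H413.K2E3CharLettersLeThreeDefs

namespace Summit.HodgeConjecture.HodgeConjecture.Cruxes.H413.K2E3HFieldsLeThree

/-! ## §1 Generic: (E⊆R)_H and the S12a projections from the pin SHAPES (abstract carriers, abstract regularity predicate `Reg`) -/

section Generic

variable {G H : Type} [Group G] [TopologicalSpace G] [IsTopologicalGroup G] [MeasurableSpace G]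
  [∀ γ : G, MeasurableSpace (G ⧸ Subgroup.centralizer ({γ} : Set G))] [MeasurableSpace (G ⧸ Subgroup.center G)]
  [Group H] [TopologicalSpace H] [IsTopologicalGroup H] [MeasurableSpace H]

end Generic

/-! ## §2 The pins on the organ's carriers `(U(Φ₃)(L⁺_v), H_v)`, `H_v = U(Φ₂)(L⁺_v) × U(Φ₁)(L⁺_v)`, and what they discharge -/

section U3

variable (L : Type) [Field L] [NumberField L] [IsCMField L] (v : HeightOneSpectrum (𝓞 ↥(maximalRealSubfield L)))

/-! ## §3 «CHAR-FIELD-H★»: the (P4) clauses at the Steinberg label, from Harish-Chandra on `U(Φ₂)(L⁺_v)` [§1.6 p. 5] ⊗ the smooth character `χ₁` on the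
compact `U(Φ₁)(L⁺_v)` — `χ_{St_H}(γ₂, γ₁) = Θ_{St₂}(γ₂) · χ₁(γ₁)` through ★ `HLengthTwoLabels.exists_eq_boxChar` and the box-character identity -/

set_option maxHeartbeats 1600000 in
-- carrier-level instance transport (`borel` on the factors vs the organ's Borel σ-algebra on the product) and ~10 ★ calls at the `cmDatum` spellings (measured)
/-- **«CHAR-FIELD-H★» — the Steinberg label HAS a Harish-Chandra character function on `H_v`.**  At a NON-SPLIT finite place `v`, under the named fact ★
`characterLocallyIntegrableLeThree` [Rogawski1990 §1.6 p. 5, Harish-Chandra], for ANY Borel σ-algebra instance and ANY Haar measure `νHv` on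
`H_v = U(Φ₂)(L⁺_v) × U(Φ₁)(L⁺_v)` (the organ's binders), and any labels `(π₁, πSt)` of the length-two principal series `i_H(χ₂ ⊠ χ₁)` (★ `HLengthTwoLabels`, `χ₁`
continuous): there is `Θ : H_v → ℂ`, measurable, locally integrable for `νHv`, locally constant at every `G`-regular point of `H_v` (pin (P2)), with
`Tr πSt(f^H) = ∫ f^H · Θ dνHv` on `C_c^∞(H_v)` — the four (P4) clauses.  Construction: `πSt = πSt₂ ⊠ χ₁` (★ `HLengthTwoLabels.exists_eq_boxChar`; `πSt₂` a constituent of the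
admissible `i_{U(Φ₂)}(χ₂)`, hence admissible), `Θ₂` = Harish-Chandra's character of `πSt₂` (★ S1 «CHAR-FIELD★» at `N = 2`, against the Haar measure `μ₂` on `U(Φ₂)(L⁺_v)` with
`μ₂ ⊗ μ₁ = νHv`), `Θ(γ₂, γ₁) := Θ₂(γ₂) · χ₁(γ₁)`, and ★ «BOXCHAR-FN★» (`tr (ρ ⊠ χ)(f) = ∫ f · (Θ_ρ ⊗ χ)`, Fubini on the compact factor).
[cite: Rogawski1990, §1.6 p. 5; §12.1 pp. 171–172; §12.5 p. 183] [cite: HarishChandra1999AdmissibleDistributions, Thm. 16.3] -/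
theorem exists_charSt
    (hHC : characterLocallyIntegrableLeThree)
    (w : PlacesOver L v) (hw : IsCMField.complexConj L • w.1 = w.1)
    [inst : MeasurableSpace ((UnitaryGroup.cmDatum L 2 (Matrix.of fun i j : Fin 2 => if i.val + j.val + 1 = 2 then (1 : L) else 0)).Local v ×
        (UnitaryGroup.cmDatum L 1 (Matrix.of fun i j : Fin 1 => if i.val + j.val + 1 = 1 then (1 : L) else 0)).Local v)] [BorelSpace ((UnitaryGroup.cmDatum L 2 (Matrix.of fun i j : Fin 2 => if i.val + j.val + 1 = 2 then (1 : L) else 0)).Local v ×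
        (UnitaryGroup.cmDatum L 1 (Matrix.of fun i j : Fin 1 => if i.val + j.val + 1 = 1 then (1 : L) else 0)).Local v)]
    (νHv : Measure ((UnitaryGroup.cmDatum L 2 (Matrix.of fun i j : Fin 2 => if i.val + j.val + 1 = 2 then (1 : L) else 0)).Local v ×
        (UnitaryGroup.cmDatum L 1 (Matrix.of fun i j : Fin 1 => if i.val + j.val + 1 = 1 then (1 : L) else 0)).Local v)) [νHv.IsHaarMeasure]
    (χ₂ : ↥(torusU (conjLocal L (IsCMField.complexConj L) v) (cmLocalForm L 2 v)) →* ℂˣ)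
    (χ₁ : (UnitaryGroup.cmDatum L 1 (Matrix.of fun i j : Fin 1 => if i.val + j.val + 1 = 1 then (1 : L) else 0)).Local v →* ℂˣ) (hχ₁c : Continuous fun x => ((χ₁ x : ℂˣ) : ℂ))
    (π₁ πSt : IrrClass ((UnitaryGroup.cmDatum L 2 (Matrix.of fun i j : Fin 2 => if i.val + j.val + 1 = 2 then (1 : L) else 0)).Local v ×
        (UnitaryGroup.cmDatum L 1 (Matrix.of fun i j : Fin 1 => if i.val + j.val + 1 = 1 then (1 : L) else 0)).Local v))
    (hlab : HLengthTwoLabels L v χ₂ χ₁ π₁ πSt) :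
    ∃ Θ : (UnitaryGroup.cmDatum L 2 (Matrix.of fun i j : Fin 2 => if i.val + j.val + 1 = 2 then (1 : L) else 0)).Local v ×
        (UnitaryGroup.cmDatum L 1 (Matrix.of fun i j : Fin 1 => if i.val + j.val + 1 = 1 then (1 : L) else 0)).Local v → ℂ,
      Measurable Θ ∧ LocallyIntegrable Θ νHv ∧
      (∀ x : (UnitaryGroup.cmDatum L 2 (Matrix.of fun i j : Fin 2 => if i.val + j.val + 1 = 2 then (1 : L) else 0)).Local v ×
        (UnitaryGroup.cmDatum L 1 (Matrix.of fun i j : Fin 1 => if i.val + j.val + 1 = 1 then (1 : L) else 0)).Local v, IsLocalGRegular L v x → ∀ᶠ y in 𝓝 x, Θ y = Θ x) ∧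
      ∀ fH : (UnitaryGroup.cmDatum L 2 (Matrix.of fun i j : Fin 2 => if i.val + j.val + 1 = 2 then (1 : L) else 0)).Local v ×
        (UnitaryGroup.cmDatum L 1 (Matrix.of fun i j : Fin 1 => if i.val + j.val + 1 = 1 then (1 : L) else 0)).Local v → ℂ, IsLocSmooth fH → πSt.smoothTrace νHv fH = ∫ h, fH h * Θ h ∂νHv := by
  classical
  -- Borel σ-algebras on the two factors; non-archimedean ∕ compactness instances
  letI iG₂ : MeasurableSpace ((UnitaryGroup.cmDatum L 2 (Matrix.of fun i j : Fin 2 => if i.val + j.val + 1 = 2 then (1 : L) else 0)).Local v) := borel _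
  haveI : BorelSpace ((UnitaryGroup.cmDatum L 2 (Matrix.of fun i j : Fin 2 => if i.val + j.val + 1 = 2 then (1 : L) else 0)).Local v) := ⟨rfl⟩
  letI iG₁ : MeasurableSpace ((UnitaryGroup.cmDatum L 1 (Matrix.of fun i j : Fin 1 => if i.val + j.val + 1 = 1 then (1 : L) else 0)).Local v) := borel _
  haveI : BorelSpace ((UnitaryGroup.cmDatum L 1 (Matrix.of fun i j : Fin 1 => if i.val + j.val + 1 = 1 then (1 : L) else 0)).Local v) := ⟨rfl⟩
  haveI : NonarchimedeanGroup ((UnitaryGroup.cmDatum L 2 (Matrix.of fun i j : Fin 2 => if i.val + j.val + 1 = 2 then (1 : L) else 0)).Local v) :=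
    nonarchimedeanGroup_unitaryGroupOfForm_local (E := L) (c := IsCMField.complexConj L) (N := 2) (v := v)
      (J' := (adelicForm L 2 (Matrix.of fun i j : Fin 2 => if i.val + j.val + 1 = 2 then (1 : L) else 0)).map (adeleToLocal L v))
  haveI : NonarchimedeanGroup ((UnitaryGroup.cmDatum L 1 (Matrix.of fun i j : Fin 1 => if i.val + j.val + 1 = 1 then (1 : L) else 0)).Local v) :=
    nonarchimedeanGroup_unitaryGroupOfForm_local (E := L) (c := IsCMField.complexConj L) (N := 1) (v := v)
      (J' := (adelicForm L 1 (Matrix.of fun i j : Fin 1 => if i.val + j.val + 1 = 1 then (1 : L) else 0)).map (adeleToLocal L v))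
  haveI : CompactSpace ((UnitaryGroup.cmDatum L 1 (Matrix.of fun i j : Fin 1 => if i.val + j.val + 1 = 1 then (1 : L) else 0)).Local v) := compactSpace_cmDatum_local_one_of_smul_eq L v w hw
  -- the organ's σ-algebra on the product IS the product of the factor Borel σ-algebras (second countability)
  have hinst : inst = Prod.instMeasurableSpace :=
    (‹BorelSpace ((UnitaryGroup.cmDatum L 2 (Matrix.of fun i j : Fin 2 => if i.val + j.val + 1 = 2 then (1 : L) else 0)).Local v ×
        (UnitaryGroup.cmDatum L 1 (Matrix.of fun i j : Fin 1 => if i.val + j.val + 1 = 1 then (1 : L) else 0)).Local v)›.measurable_eq).trans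
      (@BorelSpace.measurable_eq ((UnitaryGroup.cmDatum L 2 (Matrix.of fun i j : Fin 2 => if i.val + j.val + 1 = 2 then (1 : L) else 0)).Local v ×
        (UnitaryGroup.cmDatum L 1 (Matrix.of fun i j : Fin 1 => if i.val + j.val + 1 = 1 then (1 : L) else 0)).Local v) _ Prod.instMeasurableSpace Prod.borelSpace).symm
  subst hinst
  -- `πSt = πSt₂ ⊠ χ₁`, `πSt₂` admissible
  have hχ₁ : IsOpen ((χ₁.ker : Subgroup ((UnitaryGroup.cmDatum L 1 (Matrix.of fun i j : Fin 1 => if i.val + j.val + 1 = 1 then (1 : L) else 0)).Local v)) : Set ((UnitaryGroup.cmDatum L 1 (Matrix.of fun i j : Fin 1 => if i.val + j.val + 1 = 1 then (1 : L) else 0)).Local v)) :=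
    F0P3bHPrincipalSeriesJHOfUTwo.isOpen_ker_of_continuous_unitsComplex χ₁ hχ₁c
  obtain ⟨π₁₂, πSt₂, -, hSt, -, hJH⟩ := HLengthTwoLabels.exists_eq_boxChar (hχ₁ := hχ₁) hlab
  have hadm : πSt₂.IsAdmissible := by
    haveI := locallyCompactSpace_cmBorelU L 2 v
    exact F0P3XiPacketFamilyOfRecord.isAdmissible_of_isConstituentOf ((hJH πSt₂).2 (Or.inr rfl))
      (isAdmissible_cmPrincipalSeries_of_iwasawa L 2 v (exists_borel_mul_mem_cmLocalIntegralLevel L 2 v) χ₂)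
  -- Haar measures on the factors with `μ₂ ⊗ μ₁ = νHv`
  set μ₁ : Measure ((UnitaryGroup.cmDatum L 1 (Matrix.of fun i j : Fin 1 => if i.val + j.val + 1 = 1 then (1 : L) else 0)).Local v) := Measure.haar with hμ₁
  set μ₀ : Measure ((UnitaryGroup.cmDatum L 2 (Matrix.of fun i j : Fin 2 => if i.val + j.val + 1 = 2 then (1 : L) else 0)).Local v) := Measure.haar with hμ₀
  have hc := Measure.haarScalarFactor_pos_of_isHaarMeasure νHv (μ₀.prod μ₁)
  set μ₂ : Measure ((UnitaryGroup.cmDatum L 2 (Matrix.of fun i j : Fin 2 => if i.val + j.val + 1 = 2 then (1 : L) else 0)).Local v) := ((νHv.haarScalarFactor (μ₀.prod μ₁) : ℝ≥0∞)) • μ₀ with hμ₂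
  haveI : μ₂.IsHaarMeasure := Measure.IsHaarMeasure.smul μ₀ (ENNReal.coe_ne_zero.2 hc.ne') ENNReal.coe_ne_top
  have hprod : μ₂.prod μ₁ = νHv := by
    rw [hμ₂, Measure.prod_smul_left, Measure.coe_nnreal_smul]
    exact (Measure.isMulLeftInvariant_eq_smul νHv (μ₀.prod μ₁)).symm
  -- Harish-Chandra's character of `πSt₂` (★ S1 at `N = 2`)
  obtain ⟨Θ₂, hm₂, hli₂, hlc₂, htr₂⟩ :=
    K2E3CharFieldLeThree.exists_charRegular_of_characterLocallyIntegrable_of_nonsplit L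
      (Matrix.of fun i j : Fin 2 => if i.val + j.val + 1 = 2 then (1 : L) else 0) v hHC (by norm_num) (by norm_num)
      (antidiagOne_isHermitian L 2) (isUnit_antidiagOne_det L 2).ne_zero w hw μ₂ πSt₂
  refine ⟨fun p => Θ₂ p.1 * ((χ₁ p.2 : ℂˣ) : ℂ), F0P3cStCharTSBoxCharFn.measurable_boxCharFn hm₂ hχ₁c, ?_, ?_, ?_⟩
  · rw [← hprod]
    exact F0P3cStCharTSBoxCharFn.locallyIntegrable_boxCharFn μ₂ μ₁ hli₂ hχ₁c
  · intro x hx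
    exact F0P3cStCharTSBoxCharFn.eventually_boxCharFn_eq hχ₁ (hlc₂ x.1 (F0P3cStCharTSHFields.isRegularElt_fst_of_isLocalGRegular L v x hx)) x.2
  · intro fH hfH
    rw [hSt, ← hprod]
    exact F0P3cStCharTSBoxCharFn.smoothTrace_boxChar_eq_integral μ₂ μ₁ πSt₂ hadm χ₁ hχ₁ hχ₁c Θ₂ hli₂ htr₂ fH hfH

/-! ## §4 The junction-shaped corollary: ONE H-character value `Θ_St` and the (M1H) discharge for every datum pinned to it -/

set_option maxHeartbeats 1600000 in
-- as §3 (the statement repeats the organ's carrier spellings)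
/-- **«H-FIELDS» FOR THE RUNG-0 ASSEMBLER.**  At a NON-SPLIT `v`, under ★ `characterLocallyIntegrableLeThree`, for the organ's σ-algebra and Haar measure `νHv` on `H_v` and
labels `(π₁, πSt)` (★ `HLengthTwoLabels`, `χ₁` continuous): there is ONE function `Θ_St : H_v → ℂ` with the four (P4) clauses (§3), such that EVERY §12.5 datum `𝔇` on
`(U(Φ₃)(L⁺_v), H_v)` with COMPAT `𝔇.μH = νHv`, the field value `𝔇.charH πSt = Θ_St`, the pins (P2) hRegH ∕ (P3) hEH, and hSq `𝔇.sqPacketsH = {{πSt}}` satisfies the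
socket (M1H) `PacketCharHRegularity` as soon as the ONE named sentence «`Θ_St` is a stable class function on `H^r`» [§12.5 p. 183; §12.7 p. 191; §11.1] is
supplied for `𝔇.stConjH` (pin (P1): `IsLocalStablyConjH L v`). [cite: Rogawski1990, §1.6 p. 5; §12.5 pp. 183–184; §12.7 p. 191]
[cite: HarishChandra1999AdmissibleDistributions, Thm. 16.3] -/
theorem exists_charSt_packetCharHRegularity
    (hHC : characterLocallyIntegrableLeThree)
    (w : PlacesOver L v) (hw : IsCMField.complexConj L • w.1 = w.1)
    [MeasurableSpace (Gqs L v)]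
    [∀ γ : Gqs L v, MeasurableSpace (Gqs L v ⧸ Subgroup.centralizer ({γ} : Set (Gqs L v)))]
    [MeasurableSpace (Gqs L v ⧸ Subgroup.center (Gqs L v))]
    [MeasurableSpace ((UnitaryGroup.cmDatum L 2 (Matrix.of fun i j : Fin 2 => if i.val + j.val + 1 = 2 then (1 : L) else 0)).Local v ×
        (UnitaryGroup.cmDatum L 1 (Matrix.of fun i j : Fin 1 => if i.val + j.val + 1 = 1 then (1 : L) else 0)).Local v)] [BorelSpace ((UnitaryGroup.cmDatum L 2 (Matrix.of fun i j : Fin 2 => if i.val + j.val + 1 = 2 then (1 : L) else 0)).Local v ×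
        (UnitaryGroup.cmDatum L 1 (Matrix.of fun i j : Fin 1 => if i.val + j.val + 1 = 1 then (1 : L) else 0)).Local v)]
    (νHv : Measure ((UnitaryGroup.cmDatum L 2 (Matrix.of fun i j : Fin 2 => if i.val + j.val + 1 = 2 then (1 : L) else 0)).Local v ×
        (UnitaryGroup.cmDatum L 1 (Matrix.of fun i j : Fin 1 => if i.val + j.val + 1 = 1 then (1 : L) else 0)).Local v)) [νHv.IsHaarMeasure]
    (χ₂ : ↥(torusU (conjLocal L (IsCMField.complexConj L) v) (cmLocalForm L 2 v)) →* ℂˣ)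
    (χ₁ : (UnitaryGroup.cmDatum L 1 (Matrix.of fun i j : Fin 1 => if i.val + j.val + 1 = 1 then (1 : L) else 0)).Local v →* ℂˣ) (hχ₁c : Continuous fun x => ((χ₁ x : ℂˣ) : ℂ))
    (π₁ πSt : IrrClass ((UnitaryGroup.cmDatum L 2 (Matrix.of fun i j : Fin 2 => if i.val + j.val + 1 = 2 then (1 : L) else 0)).Local v ×
        (UnitaryGroup.cmDatum L 1 (Matrix.of fun i j : Fin 1 => if i.val + j.val + 1 = 1 then (1 : L) else 0)).Local v))
    (hlab : HLengthTwoLabels L v χ₂ χ₁ π₁ πSt) :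
    ∃ Θ : (UnitaryGroup.cmDatum L 2 (Matrix.of fun i j : Fin 2 => if i.val + j.val + 1 = 2 then (1 : L) else 0)).Local v ×
        (UnitaryGroup.cmDatum L 1 (Matrix.of fun i j : Fin 1 => if i.val + j.val + 1 = 1 then (1 : L) else 0)).Local v → ℂ,
      (Measurable Θ ∧ LocallyIntegrable Θ νHv ∧
        (∀ x : (UnitaryGroup.cmDatum L 2 (Matrix.of fun i j : Fin 2 => if i.val + j.val + 1 = 2 then (1 : L) else 0)).Local v ×
        (UnitaryGroup.cmDatum L 1 (Matrix.of fun i j : Fin 1 => if i.val + j.val + 1 = 1 then (1 : L) else 0)).Local v, IsLocalGRegular L v x → ∀ᶠ y in 𝓝 x, Θ y = Θ x) ∧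
        ∀ fH : (UnitaryGroup.cmDatum L 2 (Matrix.of fun i j : Fin 2 => if i.val + j.val + 1 = 2 then (1 : L) else 0)).Local v ×
        (UnitaryGroup.cmDatum L 1 (Matrix.of fun i j : Fin 1 => if i.val + j.val + 1 = 1 then (1 : L) else 0)).Local v → ℂ, IsLocSmooth fH → πSt.smoothTrace νHv fH = ∫ h, fH h * Θ h ∂νHv) ∧
      ∀ 𝔇 : EllipticData (Gqs L v) ((UnitaryGroup.cmDatum L 2 (Matrix.of fun i j : Fin 2 => if i.val + j.val + 1 = 2 then (1 : L) else 0)).Local v ×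
        (UnitaryGroup.cmDatum L 1 (Matrix.of fun i j : Fin 1 => if i.val + j.val + 1 = 1 then (1 : L) else 0)).Local v),
        𝔇.μH = νHv → 𝔇.charH πSt = Θ →
        (∀ a, a ∈ 𝔇.regH ↔ IsLocalGRegular L v a) →
        (∀ a, a ∈ 𝔇.ellH ↔ IsLocalGRegular L v a ∧
          IsCompact ((Subgroup.centralizer ({a} : Set ((UnitaryGroup.cmDatum L 2 (Matrix.of fun i j : Fin 2 => if i.val + j.val + 1 = 2 then (1 : L) else 0)).Local v ×
        (UnitaryGroup.cmDatum L 1 (Matrix.of fun i j : Fin 1 => if i.val + j.val + 1 = 1 then (1 : L) else 0)).Local v)) :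
              Subgroup ((UnitaryGroup.cmDatum L 2 (Matrix.of fun i j : Fin 2 => if i.val + j.val + 1 = 2 then (1 : L) else 0)).Local v ×
        (UnitaryGroup.cmDatum L 1 (Matrix.of fun i j : Fin 1 => if i.val + j.val + 1 = 1 then (1 : L) else 0)).Local v)) :
            Set ((UnitaryGroup.cmDatum L 2 (Matrix.of fun i j : Fin 2 => if i.val + j.val + 1 = 2 then (1 : L) else 0)).Local v ×
        (UnitaryGroup.cmDatum L 1 (Matrix.of fun i j : Fin 1 => if i.val + j.val + 1 = 1 then (1 : L) else 0)).Local v))) →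
        𝔇.sqPacketsH = {({πSt} : Finset (IrrClass ((UnitaryGroup.cmDatum L 2 (Matrix.of fun i j : Fin 2 => if i.val + j.val + 1 = 2 then (1 : L) else 0)).Local v ×
        (UnitaryGroup.cmDatum L 1 (Matrix.of fun i j : Fin 1 => if i.val + j.val + 1 = 1 then (1 : L) else 0)).Local v)))} →
        IsStableClassFunOn 𝔇.stConjH 𝔇.regH Θ →
        𝔇.PacketCharHRegularity := by
  obtain ⟨Θ, hm, hli, hlc, htr⟩ := exists_charSt L v hHC w hw νHv χ₂ χ₁ hχ₁c π₁ πSt hlab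
  refine ⟨Θ, ⟨hm, hli, hlc, htr⟩, fun 𝔇 hμH hch hRegH hEH hSq hstab => ?_⟩
  refine F0P3cStCharTSHFields.packetCharHRegularity_of_pins L v νHv 𝔇 πSt hμH hRegH hEH hSq ?_ ?_
  · rw [hch]
    exact ⟨hm, hli, fun x hx => hlc x ((hRegH x).1 hx), htr⟩
  · rw [hch]
    exact hstab

/-! ## §5 (P5) «CARTAN-ELL-H» — the ∃-fact TEXT (elliptic Cartan representatives of `H_v` with Haar probability measures) kernel-checked as a `Prop`, and its projection
to the (P5)∕S12a structure hypotheses at a datum with `cartanH := SH`, `μTH := μTHf` -/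

end U3

end Summit.HodgeConjecture.HodgeConjecture.Cruxes.H413.K2E3HFieldsLeThree

end
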